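import Summits.Langlands.Statement
import HarnessLib

/-!
# Birth skeleton (BC3) for the child `ReciprocityDataNonempty` (N) of the split of
`FifteenLocusEisenstein.SectorComplement` (stmt-Langlands-16058) — line `birth16058_ReciprocityDataNonempty`

N = `∀ K, Nonempty (ReciprocityData K)` (the summit's non-vacuity conjunct) from the two theorems in print it bundles:

* `stub_llcExists` — Harris–Taylor 2001 Thm. A / Henniart 2000: a local Langlands datum for the general linear groups over
  every completion `K_v` (in the tree: the T0 named fact `LocalLanglandsDatum.nonempty`, instantiated at `v.adicCompletion K`);
* `stub_llcCanonical` — local class field theory: such a datum can be taken NORMALISED against THE local Artin map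
  `canonicalArtin (K_v)` together with the Artin maps of its `ε`-system at every finite `E/K_v` (Serre, *Local Fields* XIII §4;
  in the tree `LocalArtinData.IsCanonical`, Lubin–Tate pin `isCanonical_ofExistsIsLocalArtinMap`; the re-normalisation
  transports `rec_n` and Deligne's `ε₀` along the unique isomorphism of Artin data).

Composition `ReciprocityDataNonempty_of`: choose the canonical datum at every place.  Imports `Summits.Langlands.Statement`
only.  Sorries: exactly the two stubs.
-/

noncomputable section

set_option linter.dupNamespace false

open scoped NumberField Classical Polynomial
open Filter IsDedekindDomain Polynomial
open Literature.NumberTheory.Automorphic Literature.NumberTheory.GaloisRepresentations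
open Summit.Langlands

namespace Summit.Langlands.Langlands.Cruxes.SectorComplement.Birth16058ReciprocityDataNonempty

/-- **stub — local Langlands data exist at every completion** (Harris–Taylor Thm. A). [cite: HarrisTaylorAMS2001, Thm. A] -/
theorem stub_llcExists : ∀ (K : Type) [Field K] [NumberField K] (v : IsDedekindDomain.HeightOneSpectrum (NumberField.RingOfIntegers K)), Nonempty (Literature.NumberTheory.Automorphic.LocalLanglandsDatum (v.adicCompletion K)) := by
  sorry

/-- **stub — canonical normalisation** (local class field theory pin). [cite: SerreLocalFields1979, Ch. XIII §4 Thm. 1–2] -/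
theorem stub_llcCanonical : ∀ (K : Type) [Field K] [NumberField K] (v : IsDedekindDomain.HeightOneSpectrum (NumberField.RingOfIntegers K)), Nonempty (Literature.NumberTheory.Automorphic.LocalLanglandsDatum (v.adicCompletion K)) → ∃ d : Literature.NumberTheory.Automorphic.LocalLanglandsDatum (v.adicCompletion K), d.artin.IsCanonical ∧ ∀ (E : Type) [Field E] [ValuativeRel E] [TopologicalSpace E] [IsNonarchimedeanLocalField E] [Algebra (v.adicCompletion K) E] [FiniteDimensional (v.adicCompletion K) E], (d.eps.artin E).IsCanonical := by
  sorry

/-- **N from the two stubs.** [folklore] -/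
theorem ReciprocityDataNonempty_of :
    (∀ (K : Type) [Field K] [NumberField K] (v : IsDedekindDomain.HeightOneSpectrum (NumberField.RingOfIntegers K)), Nonempty (Literature.NumberTheory.Automorphic.LocalLanglandsDatum (v.adicCompletion K))) →
    (∀ (K : Type) [Field K] [NumberField K] (v : IsDedekindDomain.HeightOneSpectrum (NumberField.RingOfIntegers K)), Nonempty (Literature.NumberTheory.Automorphic.LocalLanglandsDatum (v.adicCompletion K)) → ∃ d : Literature.NumberTheory.Automorphic.LocalLanglandsDatum (v.adicCompletion K), d.artin.IsCanonical ∧ ∀ (E : Type) [Field E] [ValuativeRel E] [TopologicalSpace E] [IsNonarchimedeanLocalField E] [Algebra (v.adicCompletion K) E] [FiniteDimensional (v.adicCompletion K) E], (d.eps.artin E).IsCanonical) →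
    (∀ (K : Type) [Field K] [NumberField K], Nonempty (ReciprocityData K)) := by
  intro h₁ h₂ K _ _
  have h := fun v : IsDedekindDomain.HeightOneSpectrum (NumberField.RingOfIntegers K) => h₂ K v (h₁ K v)
  refine ⟨⟨fun v => (h v).choose, fun v => (h v).choose_spec.1, ?_⟩⟩
  intro v E _ _ _ _ _ _
  exact (h v).choose_spec.2 E

/-- N (text) from the stubs. -/
theorem ReciprocityDataNonempty_of_stubs : ∀ (K : Type) [Field K] [NumberField K], Nonempty (ReciprocityData K) :=
  ReciprocityDataNonempty_of stub_llcExists stub_llcCanonical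

end Summit.Langlands.Langlands.Cruxes.SectorComplement.Birth16058ReciprocityDataNonempty

end
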